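import Literature.MathematicalPhysics.QuantumFieldTheory.Balaban1983to89.Setup

/-!
# T4InfraredHorizon — the infrared horizon of Bałaban's coupling flow, the small-field/large-field decomposition
# window, the reach, and «per-volume clustering is not a gap» (cell `ym-beyond`, seat P1 «RG into the infrared»;
# README §1 rungs R2a/R2b; bookkeeping)

HONEST FRAMING (cell `ym-beyond`, HUMAN RULINGS D-0035 / D-0037).  The cell's ladder is framed around the full Clay
statement (existence of quantum Yang–Mills on ℝ⁴ with a mass gap); THIS module is three rungs BELOW it and asserts
NOTHING about Yang–Mills, about Bałaban's renormalization-group objects, or about any measure.  It is the KERNEL part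
of the answer to the seat's question «what is the typed statement at which Bałaban's flow, continued PAST the unit
scale, stops being controlled, and which estimate fails first?»: elementary real arithmetic about ONE abstract run of
the coupling recursion `Setup.Flow` ((0.20) of [Balaban1987RG1]: `1/g_k² = 1/g_{k+1}² + β_{k+1}(g_k)`), consumed
through the tree predicates `Flow.SatisfiesRG` and `Flow.InInterval` only, plus the two-constraint arithmetic of a
field-amplitude threshold.  Every theorem is [folklore] real analysis (telescoping, `Real.sqrt`, `Real.log`,
`Real.exp`); value = kernel bookkeeping of implications ⇐ named inputs; NOT summit progress.  Companion memo:
`run/shared/lean/pub/ym-beyond/ROUTE-P1.md` §§0–3, §10–§11 (refereed, cell referee baseline v0.7).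

Printed context (page-cited; quoted for CONTEXT only — no disputed step is used).  The standing hypothesis of every
d = 4 theorem of the series is `0 < g_k ≤ γ, k = 0,…,K` ([Balaban1987RG1] Thm 1 p. 256, tree `Flow.InInterval`);
the running is two-sided logarithmic, (0.31) p. 259 (tree `Flow.LogRunning`; only its LOWER half `β ≥ b > 0` —
asymptotic freedom — is used for the horizon, only its UPPER half `β ≤ β'` for the reach).  The small-field
threshold profile is `p₀(g) = A₀ (log g⁻²)^{p₀}` ([Balaban1988Convergent] (1.1) p. 246, tree `p0Profile`), and the
large-field suppression is imposed in print RELATIVELY, as «beats every power of g_k»: [Balaban1988Convergent] (2.31)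
p. 260 `|R^{(j)}(X,(U,J))| ≤ g_j^{κ₀} exp(−κ d_j(X))`, [Balaban1989LargeFieldII] p. 360 ("suppresses all powers").
Dimock's three-paper exposition of the method for φ⁴₃ uses the same two-constraint threshold `p_k = (−log λ_k)^p`
([Dimock2013] = arXiv:1108.1335, p. 11; [Dimock2013BalabanII] = arXiv:1212.5562, p. 3: large-field regions are
"bounded by e^{−O(1)p₀²}|Ω₁^c|_M … sufficient to … control the sum over Ω₁").

What is proved (all [folklore]).
§1 HORIZON.  `irHorizon`: along a run obeying (0.20) up to step `K + j` whose β-functions are `≥ b` on the steps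
   past `K`, `InInterval γ (K + j)` forces `j·b ≤ 1/g_K² − 1/γ²`; `not_inInterval_beyond_horizon`: for every
   `j > (1/g_K² − 1/γ²)/b` the standing hypothesis is FALSE — the first estimate that fails when the flow is continued
   past the unit scale is the standing hypothesis itself; `no_unbounded_ir_continuation`.  (Flow-level twin of
   `CrossoverLedger.WeakCouplingFront.betaEff_le`.)
§2 PINCH.  The threshold `p` serves two opposite requirements, (LF) `C·exp(−c₁p²) ≤ 1` (suppression beats entropy)
   and (SF) `g·p^a ≤ c₂` (the small-field expansion converges); `decompWindow_iff`: a threshold exists iff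
   `g ≤ g× := c₂ / pMin^a`, `pMin = √(log C / c₁)` — an initial segment with explicit end, for ANY profile
   (`le_gCross_of_profile`); the relative criterion is VACUOUS at `g = 1` (`lfBeatsPower_one`) and Bałaban's printed
   profile vanishes there (`p0Profile_one`, `not_lfSuppressed_p0Profile_one`); `crossover_steps` /
   `window_fails_beyond_crossover`: PINCH ∘ HORIZON — with the window required at every scale the number of controlled
   infrared steps past `K` is at most `(1/g_K² − 1/g×²)/b`, determined by the technique's constants alone.  Nothing is
   asserted about Bałaban's actual constants `c₁, C, c₂, a` (uncomputed in print).
§3 REACH and R2b.  `inInterval_extend` / `irReach_steps`: the converse — with β ≤ β' the standing hypothesis EXTENDS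
   for `(1/g_K² − 1/γ²)/β'` steps (at fixed γ a finite explicit number: the femto-universe family of the memo §11);
   `clusteringPerVolume_of_bounded` / `clusteringPerVolume_fixedConstant`: PER-VOLUME exponential clustering of
   bounded correlations is content-free (any rate with constant `B e^{m·diam}`, or rate `∼ 1/diam` at fixed
   constant) — the kernel form of ruling D-0037's strike of README R2b; `ClusteringUniform` (one rate, one constant)
   is the currency of R2c.
-/

namespace Literature.MathematicalPhysics.QuantumFieldTheory.Balaban1983to89.T4InfraredHorizon

/-! ## §1 The infrared horizon of the flow (the typed crossover statement) -/

open Filter Topology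


section Horizon

/-- Telescoped lower running past step `K`: if (0.20) holds on `[K, K+j)` and the β-functions met there are `≥ b`,
then `1/g_{K+j}² + j·b ≤ 1/g_K²`. [cite: Balaban1987RG1, (0.20) p.256 telescoped; lower half of (0.31) p.259] -/
theorem inv_sq_add_le (F : Flow) (K j : ℕ) (b : ℝ)
    (hrg : ∀ k, K ≤ k → k < K + j → 1 / (F.g k) ^ 2 = 1 / (F.g (k + 1)) ^ 2 + F.β (k + 1) (F.g k))
    (hb : ∀ k, K ≤ k → k < K + j → b ≤ F.β (k + 1) (F.g k)) :
    1 / (F.g (K + j)) ^ 2 + j * b ≤ 1 / (F.g K) ^ 2 := by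
  induction j with
  | zero => simp
  | succ i ih =>
    have h1 := hrg (K + i) (by omega) (by omega)
    have h2 := hb (K + i) (by omega) (by omega)
    have ih' := ih (fun k hk hk' => hrg k hk (by omega)) (fun k hk hk' => hb k hk (by omega))
    rw [show K + (i + 1) = K + i + 1 by omega]
    push_cast
    linarith

/-- **THE INFRARED HORIZON.**  Along a run obeying (0.20) up to step `K + j` whose β-functions are `≥ b` on the
steps past `K`, the standing hypothesis `0 < g_k ≤ γ, k ≤ K + j` forces `j·b ≤ 1/g_K² − 1/γ²`.
[cite: Balaban1987RG1, (0.20) p.256, (0.31) p.259 and Thm 1 p.256 (standing hypothesis 0 < g_k ≤ γ); elementary consequence] -/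
theorem irHorizon (F : Flow) {K j : ℕ} {γ b : ℝ} (hrg : F.SatisfiesRG (K + j))
    (hb : ∀ k, K ≤ k → k < K + j → b ≤ F.β (k + 1) (F.g k)) (hI : F.InInterval γ (K + j)) :
    (j : ℝ) * b ≤ 1 / (F.g K) ^ 2 - 1 / γ ^ 2 := by
  have h := inv_sq_add_le F K j b (fun k _ hk => hrg k hk) hb
  obtain ⟨hpos, hle⟩ := hI (K + j) le_rfl
  have hγ : 1 / γ ^ 2 ≤ 1 / (F.g (K + j)) ^ 2 :=
    one_div_le_one_div_of_le (pow_pos hpos 2) (pow_le_pow_left₀ hpos.le hle 2)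
  linarith

/-- The horizon as a bound on the number of infrared steps: `j ≤ (1/g_K² − 1/γ²)/b`.
[cite: Balaban1987RG1, (0.20) p.256, (0.31) p.259 and Thm 1 p.256 (standing hypothesis 0 < g_k ≤ γ); elementary consequence] -/
theorem irHorizon_steps (F : Flow) {K j : ℕ} {γ b : ℝ} (hb0 : 0 < b) (hrg : F.SatisfiesRG (K + j))
    (hb : ∀ k, K ≤ k → k < K + j → b ≤ F.β (k + 1) (F.g k)) (hI : F.InInterval γ (K + j)) :
    (j : ℝ) ≤ (1 / (F.g K) ^ 2 - 1 / γ ^ 2) / b :=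
  (le_div_iff₀ hb0).mpr (irHorizon F hrg hb hI)

/-- **THE FIRST ESTIMATE THAT FAILS.**  Past the horizon the standing hypothesis of B12 Thm 1 / B16 Thm 1 is false:
with (0.20) and `β ≥ b > 0` on the infrared steps, `InInterval γ (K + j)` fails for every `j > (1/g_K² − 1/γ²)/b`.
[cite: Balaban1987RG1, (0.20) p.256, (0.31) p.259 and Thm 1 p.256 (standing hypothesis 0 < g_k ≤ γ); elementary consequence] -/
theorem not_inInterval_beyond_horizon (F : Flow) {K j : ℕ} {γ b : ℝ} (hb0 : 0 < b)
    (hrg : F.SatisfiesRG (K + j)) (hb : ∀ k, K ≤ k → k < K + j → b ≤ F.β (k + 1) (F.g k))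
    (hj : (1 / (F.g K) ^ 2 - 1 / γ ^ 2) / b < j) : ¬ F.InInterval γ (K + j) :=
  fun hI => (not_lt.mpr (irHorizon_steps F hb0 hrg hb hI)) hj

/-- Hence NO continuation of the run inside `]0, γ]` to all infrared scales exists: a uniform lower bound `b > 0`
on the β-functions (asymptotic freedom) is incompatible with an unboundedly long controlled infrared flow.
[cite: Balaban1987RG1, (0.20) p.256, (0.31) p.259 and Thm 1 p.256 (standing hypothesis 0 < g_k ≤ γ); elementary consequence] -/
theorem no_unbounded_ir_continuation (F : Flow) {K : ℕ} {γ b : ℝ} (hb0 : 0 < b)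
    (hrg : ∀ n, F.SatisfiesRG n) (hb : ∀ k, K ≤ k → b ≤ F.β (k + 1) (F.g k)) :
    ¬ ∀ j, F.InInterval γ (K + j) := by
  intro h
  obtain ⟨j, hj⟩ := exists_nat_gt ((1 / (F.g K) ^ 2 - 1 / γ ^ 2) / b)
  exact not_inInterval_beyond_horizon F hb0 (hrg (K + j)) (fun k hk _ => hb k hk) hj (h j)

end Horizon

/-! ## §2 THE PINCH BEHIND `γ`: the small-field amplitude window of the Gaussian-reference decomposition

Every small-field/large-field renormalization step about the Gaussian fixed point chooses a field-amplitude threshold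
`p` (Bałaban: `p₀(g_k) = A₀ (log g_k⁻²)^{p₀}`, tree `p0Profile`, [Balaban1988Convergent] (1.1) p. 246; Dimock:
`p_k = (−log λ_k)^p`, arXiv:1108.1335 p. 11) subject to TWO opposite requirements:
(LF) a large-field cube must cost more than its entropy — `C · exp(−c₁ p²) ≤ 1` (Dimock II, arXiv:1212.5562 p. 3:
"bounded by e^{−O(1)p₀²}|Ω₁^c|_M … sufficient to … control the sum over Ω₁");
(SF) the anharmonic part of the action restricted to fields of amplitude `≤ p` must be a convergent perturbation —
`g · p^a ≤ c₂` (Bałaban's expansion parameter `g_k · poly(p₀(g_k), L, M)`, leg-1 SMALLNESS §4.5; Dimock I p. 16: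
"let λ_k be sufficiently small (depending on L, M)").
The theorems below are elementary real analysis: the set of couplings admitting a threshold is EXACTLY the initial
segment `]0, c₂ / pMin^a]`, `pMin = √(log C / c₁)`; the RELATIVE criterion «suppression beats every power of g»
([Balaban1989LargeFieldII] p. 360 "suppresses all powers of log g_k⁻²", tree `B16Suppression`) is VACUOUS at `g = 1`;
and Bałaban's printed profile has `p₀(1) = 0` — no large-field suppression at all at `g = 1`.  Nothing is asserted
about Bałaban's actual constants `c₁, C, c₂, a` (uncomputed in print). -/

section Pinch

variable {c₁ C c₂ g g' p : ℝ} {a : ℕ}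

/-- (LF) LARGE-FIELD SUPPRESSION BEATS ENTROPY: activity `exp(−c₁ p²)` per large-field cube against `C` cube-histories.
[cite: Dimock2013BalabanII, p.3 («bounded by e^{−O(1)p₀²}|Ω₁^c|_M»)] [cite: Balaban1989LargeFieldII, p.360] -/
def LFSuppressed (c₁ C p : ℝ) : Prop := C * Real.exp (-(c₁ * p ^ 2)) ≤ 1

/-- (SF) SMALL-FIELD EXPANSION CONVERGES: effective size `g · p^a` of the anharmonic vertices on fields of amplitude `≤ p`.
[cite: Dimock2013, p.16 («λ_k sufficiently small depending on L, M»)] [cite: Balaban1988Convergent, (1.4) p.246] -/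
def SFConverges (c₂ : ℝ) (a : ℕ) (g p : ℝ) : Prop := g * p ^ a ≤ c₂

/-- THE DECOMPOSITION WINDOW at coupling `g`: one threshold `p > 0` serves both requirements.
[cite: Balaban1988Convergent, (1.1)–(1.4) pp.246–247 (threshold p₀(g_k), ε_k = g_k p₀(g_k))] [cite: Dimock2013, p.11 (p_k = (−log λ_k)^p), p.16] -/
def DecompWindow (c₁ C c₂ : ℝ) (a : ℕ) (g : ℝ) : Prop :=
  ∃ p : ℝ, 0 < p ∧ LFSuppressed c₁ C p ∧ SFConverges c₂ a g p

/-- The least suppressing amplitude `pMin = √(log C / c₁)`. [cite: Dimock2013BalabanII, p.3] -/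
noncomputable def pMin (c₁ C : ℝ) : ℝ := Real.sqrt (Real.log C / c₁)

/-- The crossover coupling of the method class: `g× = c₂ / pMin^a`.
[cite: Balaban1988Convergent, (1.1)–(1.4) pp.246–247 (threshold p₀(g_k), ε_k = g_k p₀(g_k))] [cite: Dimock2013, p.11 (p_k = (−log λ_k)^p), p.16] -/
noncomputable def gCross (c₁ C c₂ : ℝ) (a : ℕ) : ℝ := c₂ / pMin c₁ C ^ a

/-- (LF) in logarithmic form: `log C ≤ c₁ p²`. [cite: Dimock2013BalabanII, p.3] -/
theorem lfSuppressed_iff_log (hC : 0 < C) : LFSuppressed c₁ C p ↔ Real.log C ≤ c₁ * p ^ 2 := by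
  unfold LFSuppressed
  rw [Real.exp_neg, ← div_eq_mul_inv, div_le_one (Real.exp_pos _), Real.log_le_iff_le_exp hC]

/-- (LF) holds exactly for thresholds `p ≥ pMin`. [cite: Dimock2013BalabanII, p.3] -/
theorem lfSuppressed_iff (hc₁ : 0 < c₁) (hC : 0 < C) (hp : 0 ≤ p) : LFSuppressed c₁ C p ↔ pMin c₁ C ≤ p := by
  rw [lfSuppressed_iff_log hC, pMin, Real.sqrt_le_left hp, div_le_iff₀ hc₁, mul_comm]

/-- `0 < pMin` as soon as there is entropy to beat (`C > 1`). [cite: Dimock2013BalabanII, p.3] -/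
theorem pMin_pos (hc₁ : 0 < c₁) (hC : 1 < C) : 0 < pMin c₁ C :=
  Real.sqrt_pos.mpr (div_pos (Real.log_pos hC) hc₁)

/-- **THE WINDOW IS AN INITIAL SEGMENT WITH EXPLICIT END**: a threshold exists iff `g · pMin^a ≤ c₂`.
[cite: Balaban1988Convergent, (1.1)–(1.4) pp.246–247 (threshold p₀(g_k), ε_k = g_k p₀(g_k))] [cite: Dimock2013, p.11 (p_k = (−log λ_k)^p), p.16] -/
theorem decompWindow_iff (hc₁ : 0 < c₁) (hC : 1 < C) (hg : 0 < g) :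
    DecompWindow c₁ C c₂ a g ↔ g * pMin c₁ C ^ a ≤ c₂ := by
  constructor
  · rintro ⟨p, hp, hLF, hSF⟩
    have hle : pMin c₁ C ≤ p := (lfSuppressed_iff hc₁ (by linarith) hp.le).mp hLF
    have hpow : pMin c₁ C ^ a ≤ p ^ a := pow_le_pow_left₀ (Real.sqrt_nonneg _) hle a
    exact le_trans (mul_le_mul_of_nonneg_left hpow hg.le) hSF
  · intro h
    exact ⟨pMin c₁ C, pMin_pos hc₁ hC, (lfSuppressed_iff hc₁ (by linarith) (Real.sqrt_nonneg _)).mpr le_rfl, h⟩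

/-- Equivalently `g ≤ g× = c₂ / pMin^a`.
[cite: Balaban1988Convergent, (1.1)–(1.4) pp.246–247 (threshold p₀(g_k), ε_k = g_k p₀(g_k))] [cite: Dimock2013, p.11 (p_k = (−log λ_k)^p), p.16] -/
theorem decompWindow_iff_le_gCross (hc₁ : 0 < c₁) (hC : 1 < C) (hg : 0 < g) :
    DecompWindow c₁ C c₂ a g ↔ g ≤ gCross c₁ C c₂ a := by
  rw [decompWindow_iff hc₁ hC hg, gCross, le_div_iff₀ (pow_pos (pMin_pos hc₁ hC) a)]

/-- Monotonicity: the window is closed downwards in the coupling (no hypotheses on the constants, nor on the sign of `g'`).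
[cite: Balaban1988Convergent, (1.1)–(1.4) pp.246–247 (threshold p₀(g_k), ε_k = g_k p₀(g_k))] [cite: Dimock2013, p.11 (p_k = (−log λ_k)^p), p.16] -/
theorem decompWindow_anti (hle : g' ≤ g) (h : DecompWindow c₁ C c₂ a g) : DecompWindow c₁ C c₂ a g' := by
  obtain ⟨p, hp, hLF, hSF⟩ := h
  refine ⟨p, hp, hLF, ?_⟩
  have : g' * p ^ a ≤ g * p ^ a := mul_le_mul_of_nonneg_right hle (pow_nonneg hp.le a)
  exact le_trans this hSF

/-- **PAST `g×` NO THRESHOLD EXISTS** — the typed crossover of the technique class.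
[cite: Balaban1988Convergent, (1.1)–(1.4) pp.246–247 (threshold p₀(g_k), ε_k = g_k p₀(g_k))] [cite: Dimock2013, p.11 (p_k = (−log λ_k)^p), p.16] -/
theorem not_decompWindow_of_gCross_lt (hc₁ : 0 < c₁) (hC : 1 < C) (hg : 0 < g) (h : gCross c₁ C c₂ a < g) :
    ¬ DecompWindow c₁ C c₂ a g :=
  fun hw => (not_le.mpr h) ((decompWindow_iff_le_gCross hc₁ hC hg).mp hw)

/-- Any PROFILE choice `p = prof g` (Bałaban's `p0Profile A₀ p₀`, Dimock's `(−log λ)^p`, a power law …) that works at `g` exhibits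
the window at `g`; so the reach of every profile is bounded by `g×`.
[cite: Balaban1988Convergent, (1.1) p.246] [cite: Dimock2013, p.11] -/
theorem decompWindow_of_profile (prof : ℝ → ℝ) (hpos : 0 < prof g) (hLF : LFSuppressed c₁ C (prof g))
    (hSF : SFConverges c₂ a g (prof g)) : DecompWindow c₁ C c₂ a g :=
  ⟨prof g, hpos, hLF, hSF⟩

/-- The reach of EVERY profile choice `p = prof g` is bounded by the crossover coupling `g×` of the class constants.
[cite: Balaban1988Convergent, (1.1)–(1.4) pp.246–247 (threshold p₀(g_k), ε_k = g_k p₀(g_k))] [cite: Dimock2013, p.11 (p_k = (−log λ_k)^p), p.16] -/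
theorem le_gCross_of_profile (hc₁ : 0 < c₁) (hC : 1 < C) (hg : 0 < g) (prof : ℝ → ℝ) (hpos : 0 < prof g)
    (hLF : LFSuppressed c₁ C (prof g)) (hSF : SFConverges c₂ a g (prof g)) : g ≤ gCross c₁ C c₂ a :=
  (decompWindow_iff_le_gCross hc₁ hC hg).mp (decompWindow_of_profile prof hpos hLF hSF)

/-- (REL) THE RELATIVE CRITERION «large-field suppression beats the power gⁿ» (the shape in which print imposes it:
[Balaban1988Convergent] (2.31) `|R^{(j)}(X)| ≤ g_j^{κ₀} exp(−κ d_j(X))`, (2.46) "for κ₀ ≥ 7"; [Balaban1989LargeFieldII]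
p. 360 "suppresses all powers").
[cite: Balaban1988Convergent, (2.31) p.260 and (2.46)] [cite: Balaban1989LargeFieldII, p.360 («suppresses all powers»)] -/
def LFBeatsPower (c₁ : ℝ) (n : ℕ) (g p : ℝ) : Prop := Real.exp (-(c₁ * p ^ 2)) ≤ g ^ n

/-- For `0 < g < 1` it is a genuine lower bound on the threshold: `n · log g⁻¹ ≤ c₁ p²`.
[cite: Balaban1988Convergent, (2.31) p.260] -/
theorem lfBeatsPower_iff (hg : 0 < g) {n : ℕ} : LFBeatsPower c₁ n g p ↔ n * Real.log g⁻¹ ≤ c₁ * p ^ 2 := by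
  unfold LFBeatsPower
  rw [← Real.exp_log (pow_pos hg n), Real.exp_le_exp, Real.log_pow, Real.log_inv]
  constructor <;> intro h <;> linarith

/-- **VACUITY AT `g = 1`**: the relative criterion holds for EVERY threshold, including `p = 0` (no small-field region at all).
«Beyond all orders in g» carries no information where `g` is not small; there only (LF) is operative.
[cite: Balaban1988Convergent, (2.31) p.260 and (2.46)] [cite: Balaban1989LargeFieldII, p.360] -/
theorem lfBeatsPower_one (hc₁ : 0 ≤ c₁) (n : ℕ) (p : ℝ) : LFBeatsPower c₁ n 1 p := by
  unfold LFBeatsPower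
  rw [one_pow, Real.exp_le_one_iff]
  nlinarith [sq_nonneg p]

/-- Bałaban's printed profile VANISHES at `g = 1`: `p₀(1) = A₀ (log 1)^{p₀} = 0` (`p₀ ≥ 1`).
[cite: Balaban1988Convergent, (1.1) p.246] -/
theorem p0Profile_one (A₀ : ℝ) {p₀ : ℕ} (hp : p₀ ≠ 0) : p0Profile A₀ p₀ 1 = 0 := by
  simp [p0Profile, hp]

/-- Hence at `g = 1` the printed profile gives NO large-field suppression against any entropy constant `C > 1`.
[cite: Balaban1988Convergent, (1.1) p.246] [cite: Dimock2013BalabanII, p.3] -/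
theorem not_lfSuppressed_p0Profile_one (A₀ c₁ : ℝ) {p₀ : ℕ} (hp : p₀ ≠ 0) (hC : 1 < C) :
    ¬ LFSuppressed c₁ C (p0Profile A₀ p₀ 1) := by
  rw [p0Profile_one A₀ hp]
  simp [LFSuppressed]
  linarith

/-- The horizon of §1 read through the window: if the standing hypothesis is to keep every running coupling inside the
window (`γ ≤ g×`), the number of controlled infrared steps past `K` is at most `(1/g_K² − 1/g×²)/b`.
[cite: Balaban1987RG1, (0.20) p.256, (0.31) p.259 and Thm 1 p.256 (standing hypothesis 0 < g_k ≤ γ); elementary consequence] -/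
theorem irHorizon_of_window (F : Flow) {K j : ℕ} {γ b gx : ℝ} (hγ : 0 < γ) (hγx : γ ≤ gx) (hb0 : 0 < b)
    (hrg : F.SatisfiesRG (K + j)) (hb : ∀ k, K ≤ k → k < K + j → b ≤ F.β (k + 1) (F.g k))
    (hI : F.InInterval γ (K + j)) : (j : ℝ) ≤ (1 / (F.g K) ^ 2 - 1 / gx ^ 2) / b := by
  have h := irHorizon F hrg hb hI
  have hx : 1 / gx ^ 2 ≤ 1 / γ ^ 2 := one_div_le_one_div_of_le (pow_pos hγ 2) (pow_le_pow_left₀ hγ.le hγx 2)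
  exact (le_div_iff₀ hb0).mpr (by linarith)

/-- WINDOW ⇒ STANDING HYPOTHESIS WITH `γ = g×`: a run every coupling of which admits a decomposition window lies in `]0, g×]`.
[cite: Balaban1987RG1, Thm 1 p.256] [cite: Balaban1988Convergent, (1.4) p.246] -/
theorem inInterval_gCross_of_window (F : Flow) {n : ℕ} (hc₁ : 0 < c₁) (hC : 1 < C)
    (hW : ∀ k, k ≤ n → 0 < F.g k ∧ DecompWindow c₁ C c₂ a (F.g k)) : F.InInterval (gCross c₁ C c₂ a) n :=
  fun k hk => ⟨(hW k hk).1, (decompWindow_iff_le_gCross hc₁ hC (hW k hk).1).mp (hW k hk).2⟩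

/-- **THE TYPED CROSSOVER (PINCH ∘ HORIZON, PROVED).**  If the Gaussian-reference decomposition is to be available at every scale of
the run (each `g_k` inside the window of the class constants `c₁, C, c₂, a`), (0.20) holds and the β-functions on the infrared
steps are `≥ b > 0`, then the number of controlled infrared steps past `K` is at most `(1/g_K² − 1/g×²)/b` — FINITE, and determined
by the technique's constants alone (no `γ` left to choose).
[cite: Balaban1987RG1, (0.20) p.256, (0.31) p.259 and Thm 1 p.256 (standing hypothesis 0 < g_k ≤ γ); elementary consequence] [cite: Balaban1988Convergent, (1.1)–(1.4) pp.246–247 (threshold p₀(g_k), ε_k = g_k p₀(g_k))] [cite: Dimock2013, p.11 (p_k = (−log λ_k)^p), p.16] -/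
theorem crossover_steps (F : Flow) {K j : ℕ} {b : ℝ} (hc₁ : 0 < c₁) (hC : 1 < C) (hb0 : 0 < b)
    (hrg : F.SatisfiesRG (K + j)) (hb : ∀ k, K ≤ k → k < K + j → b ≤ F.β (k + 1) (F.g k))
    (hW : ∀ k, k ≤ K + j → 0 < F.g k ∧ DecompWindow c₁ C c₂ a (F.g k)) :
    (j : ℝ) ≤ (1 / (F.g K) ^ 2 - 1 / gCross c₁ C c₂ a ^ 2) / b :=
  irHorizon_steps F hb0 hrg hb (inInterval_gCross_of_window F hc₁ hC hW)

/-- … and past that count the window FAILS at some scale of the run: the first estimate that fails, named by the technique.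
[cite: Balaban1987RG1, (0.20) p.256, (0.31) p.259 and Thm 1 p.256 (standing hypothesis 0 < g_k ≤ γ); elementary consequence] [cite: Balaban1988Convergent, (1.1)–(1.4) pp.246–247 (threshold p₀(g_k), ε_k = g_k p₀(g_k))] [cite: Dimock2013, p.11 (p_k = (−log λ_k)^p), p.16] -/
theorem window_fails_beyond_crossover (F : Flow) {K j : ℕ} {b : ℝ} (hc₁ : 0 < c₁) (hC : 1 < C) (hb0 : 0 < b)
    (hrg : F.SatisfiesRG (K + j)) (hb : ∀ k, K ≤ k → k < K + j → b ≤ F.β (k + 1) (F.g k))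
    (hpos : ∀ k, k ≤ K + j → 0 < F.g k) (hj : (1 / (F.g K) ^ 2 - 1 / gCross c₁ C c₂ a ^ 2) / b < j) :
    ∃ k, k ≤ K + j ∧ ¬ DecompWindow c₁ C c₂ a (F.g k) := by
  by_contra h
  push Not at h
  exact (not_lt.mpr (crossover_steps F hc₁ hC hb0 hrg hb fun k hk => ⟨hpos k hk, h k hk⟩)) hj

end Pinch

/-! ## §3 REACH AT FIXED `γ` (the converse of the horizon) and «finite-volume clustering is NOT a gap», typed -/

section Reach

/-- Telescoped UPPER running past step `K`: if (0.20) holds on `[K, K+j)` and the β-functions met there are `≤ β'`, then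
`1/g_K² − j·β' ≤ 1/g_{K+j}²`. [cite: Balaban1987RG1, (0.20) p.256 telescoped; upper half of (0.31) p.259] -/
theorem inv_sq_sub_le (F : Flow) (K j : ℕ) (β' : ℝ)
    (hrg : ∀ k, K ≤ k → k < K + j → 1 / (F.g k) ^ 2 = 1 / (F.g (k + 1)) ^ 2 + F.β (k + 1) (F.g k))
    (hub : ∀ k, K ≤ k → k < K + j → F.β (k + 1) (F.g k) ≤ β') :
    1 / (F.g K) ^ 2 - j * β' ≤ 1 / (F.g (K + j)) ^ 2 := by
  induction j with
  | zero => simp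
  | succ i ih =>
    have h1 := hrg (K + i) (by omega) (by omega)
    have h2 := hub (K + i) (by omega) (by omega)
    have ih' := ih (fun k hk hk' => hrg k hk (by omega)) (fun k hk hk' => hub k hk (by omega))
    rw [show K + (i + 1) = K + i + 1 by omega]
    push_cast
    linarith

/-- **REACH (converse of the horizon).**  With (0.20) on `[K, K+j)`, β-functions `≤ β'` there (the UPPER half of B12 (0.31)),
positive couplings, and `j·β' ≤ 1/g_K² − 1/γ²`, the standing hypothesis EXTENDS from step `K` to step `K + j`.  Together with
`irHorizon_steps`: the controlled infrared continuation lasts between `(g_K⁻²−γ⁻²)/β'` and `(g_K⁻²−γ⁻²)/b` steps — at FIXED `γ` a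
finite, explicit number; the tori it exhausts are the femto-universe family of ROUTE-P1.md §11.
[cite: Balaban1987RG1, (0.20) p.256, (0.31) p.259 and Thm 1 p.256 (standing hypothesis 0 < g_k ≤ γ); elementary consequence] -/
theorem inInterval_extend (F : Flow) {K j : ℕ} {γ β' : ℝ} (hγ : 0 < γ) (hβ' : 0 ≤ β')
    (hI : F.InInterval γ K) (hrg : F.SatisfiesRG (K + j))
    (hub : ∀ k, K ≤ k → k < K + j → F.β (k + 1) (F.g k) ≤ β')
    (hpos : ∀ k, K < k → k ≤ K + j → 0 < F.g k)
    (hj : (j : ℝ) * β' ≤ 1 / (F.g K) ^ 2 - 1 / γ ^ 2) : F.InInterval γ (K + j) := by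
  intro k hk
  rcases Nat.lt_or_ge K k with hKk | hkK
  · have hgk : 0 < F.g k := hpos k hKk hk
    refine ⟨hgk, ?_⟩
    obtain ⟨i, rfl⟩ : ∃ i, k = K + i := ⟨k - K, by omega⟩
    have hi : i ≤ j := by omega
    have htel := inv_sq_sub_le F K i β' (fun k' hk' hk'' => hrg k' (by omega)) (fun k' hk' hk'' => hub k' hk' (by omega))
    have hiβ : (i : ℝ) * β' ≤ j * β' := mul_le_mul_of_nonneg_right (by exact_mod_cast hi) hβ'
    have hinv : 1 / γ ^ 2 ≤ 1 / (F.g (K + i)) ^ 2 := by linarith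
    have hsq : F.g (K + i) ^ 2 ≤ γ ^ 2 := (one_div_le_one_div (pow_pos hγ 2) (pow_pos hgk 2)).mp hinv
    exact (pow_le_pow_iff_left₀ hgk.le hγ.le two_ne_zero).mp hsq
  · exact hI k hkK

/-- The reach as a step count: every `j ≤ (1/g_K² − 1/γ²)/β'` is inside the standing hypothesis.
[cite: Balaban1987RG1, (0.20) p.256, (0.31) p.259 and Thm 1 p.256 (standing hypothesis 0 < g_k ≤ γ); elementary consequence] -/
theorem irReach_steps (F : Flow) {K j : ℕ} {γ β' : ℝ} (hγ : 0 < γ) (hβ' : 0 < β')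
    (hI : F.InInterval γ K) (hrg : F.SatisfiesRG (K + j))
    (hub : ∀ k, K ≤ k → k < K + j → F.β (k + 1) (F.g k) ≤ β')
    (hpos : ∀ k, K < k → k ≤ K + j → 0 < F.g k)
    (hj : (j : ℝ) ≤ (1 / (F.g K) ^ 2 - 1 / γ ^ 2) / β') : F.InInterval γ (K + j) :=
  inInterval_extend F hγ hβ'.le hI hrg hub hpos ((le_div_iff₀ hβ').mp hj)

/-- R2b, THE TYPED DIFFERENCE.  `cov n d` stands for (the supremum over pairs of unit-scale observables bounded by `1` at separation
`d` of) a truncated correlation on the torus of index `n`, `diam n` for its diameter; both abstract.  PER-VOLUME exponential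
clustering — rate and constant allowed to depend on the volume:
[cite: JaffeWittenClay2006, §5 (2) p.6 (clustering), per-volume form] -/
def ClusteringPerVolume (diam : ℕ → ℝ) (cov : ℕ → ℝ → ℝ) : Prop :=
  ∀ n, ∃ m : ℝ, 0 < m ∧ ∃ A : ℝ, ∀ d : ℝ, 0 ≤ d → d ≤ diam n → |cov n d| ≤ A * Real.exp (-(m * d))

/-- … versus VOLUME-UNIFORM exponential clustering (one rate, one constant: the currency of README R2c / `HasLatticeMassGap`).
[cite: JaffeWittenClay2006, §6.5 pp.11–12 («a mass gap that is uniform in the volume») and §5 (2) p.6] -/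
def ClusteringUniform (diam : ℕ → ℝ) (cov : ℕ → ℝ → ℝ) : Prop :=
  ∃ m : ℝ, 0 < m ∧ ∃ A : ℝ, ∀ n (d : ℝ), 0 ≤ d → d ≤ diam n → |cov n d| ≤ A * Real.exp (-(m * d))

/-- **PER-VOLUME CLUSTERING IS CONTENT-FREE** for bounded correlations: ANY rate `m > 0` works on each torus with the constant
`B·e^{m·diam}`.  («Finite-volume exponential clustering is NOT a mass gap», README §1 R2b.)
[cite: JaffeWittenClay2006, §6.5 pp.11–12 (uniformity in the volume is the content); elementary] -/
theorem clusteringPerVolume_of_bounded (diam : ℕ → ℝ) (cov : ℕ → ℝ → ℝ) (B : ℝ)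
    (hb : ∀ n d, |cov n d| ≤ B) : ClusteringPerVolume diam cov := by
  intro n
  refine ⟨1, one_pos, B * Real.exp (diam n), fun d hd hdn => ?_⟩
  have hB : 0 ≤ B := (abs_nonneg _).trans (hb n d)
  have hexp : (1 : ℝ) ≤ Real.exp (diam n) * Real.exp (-(1 * d)) := by
    rw [← Real.exp_add]
    exact Real.one_le_exp (by linarith)
  calc |cov n d| ≤ B := hb n d
    _ = B * 1 := (mul_one B).symm
    _ ≤ B * (Real.exp (diam n) * Real.exp (-(1 * d))) := mul_le_mul_of_nonneg_left hexp hB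
    _ = B * Real.exp (diam n) * Real.exp (-(1 * d)) := by ring

/-- Even with the constant FIXED (`A > B`) a per-volume rate exists — of order `1/diam` (the «gap ∼ 1/L» of a finite box).
[cite: JaffeWittenClay2006, §6.5 pp.11–12; elementary] -/
theorem clusteringPerVolume_fixedConstant (diam : ℕ → ℝ) (cov : ℕ → ℝ → ℝ) (B A : ℝ) (hB : 0 < B) (hA : B < A)
    (hdiam : ∀ n, 0 < diam n) (hb : ∀ n d, |cov n d| ≤ B) :
    ∀ n, ∃ m : ℝ, 0 < m ∧ ∀ d : ℝ, 0 ≤ d → d ≤ diam n → |cov n d| ≤ A * Real.exp (-(m * d)) := by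
  intro n
  have hlog : 0 < Real.log (A / B) := Real.log_pos ((one_lt_div hB).mpr hA)
  refine ⟨Real.log (A / B) / diam n, div_pos hlog (hdiam n), fun d hd hdn => ?_⟩
  have hmd : Real.log (A / B) / diam n * d ≤ Real.log (A / B) := by
    rw [div_mul_eq_mul_div, div_le_iff₀ (hdiam n)]
    exact mul_le_mul_of_nonneg_left hdn hlog.le
  have hexp : B / A ≤ Real.exp (-(Real.log (A / B) / diam n * d)) := by
    have : Real.exp (-Real.log (A / B)) = B / A := by
      rw [Real.exp_neg, Real.exp_log (div_pos (by linarith) hB), inv_div]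
    rw [← this]
    exact Real.exp_le_exp.mpr (by linarith)
  have hA0 : 0 < A := by linarith
  calc |cov n d| ≤ B := hb n d
    _ = A * (B / A) := by field_simp
    _ ≤ A * Real.exp (-(Real.log (A / B) / diam n * d)) := mul_le_mul_of_nonneg_left hexp hA0.le

/-- The uniform statement implies the per-volume one (trivially); the converse is the whole infrared problem.
[cite: JaffeWittenClay2006, §6.5 pp.11–12] -/
theorem ClusteringUniform.perVolume {diam : ℕ → ℝ} {cov : ℕ → ℝ → ℝ} (h : ClusteringUniform diam cov) :
    ClusteringPerVolume diam cov := by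
  obtain ⟨m, hm, A, hA⟩ := h
  exact fun n => ⟨m, hm, A, fun d hd hdn => hA n d hd hdn⟩

end Reach

end Literature.MathematicalPhysics.QuantumFieldTheory.Balaban1983to89.T4InfraredHorizon
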